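import Summits.CriticalPhenomena.PercolationContinuityZ3.Theorems.PercNearOneGluingNoHeavyLowerTailSahiThreeCopyTwoPointCertsK5Forms

/-!
# Sahi's three-function conjecture — `k = 5` certificate machinery II: decoders, the entry check, the orbit cover, the table

Companion of `…TwoPointCertsK5Forms` and the DATA files `…TwoPointCertsK5Data1–49` (seat `prim-sahi-p1`, generation 61; `--supports
stmt-CriticalPhenomena-4575`).  No evaluation here (pure definitions and soundness lemmas).
* Decoders of the packed entries (`tabOf5`, `nuOf5`, `lamOf5`, `faceMat5`, `halfMat0/1`; packing documented in the DATA files),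
  the extra-kernel tables (`faceTable5`, `halfTable5`, `addTable5` with their nonnegativity on up-set pairs), the entry check
  `checkEntry5` (flow form via `certOKflowXF` + face/half forms; or, for the flagged θ-only entries, the tree's pair enumeration
  `certOKfastZ` over `upList5`) and ★ `facts_of_checkEntry5`; `EntryFacts5`, `brutePiece5`/★ `entryFacts5_of_brutePieces` (the pair
  enumeration split by residue classes of the row family, `(N1)` against all masks).
The orbit cover and the table are in `…TwoPointCertsK5Table`, the per-entry checks in `…TwoPointCertsK5Check1–8` / `…Brute1a–10b`,
the theorem in `…TwoPointCertsK5`. [this work]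
-/

namespace Summit.CriticalPhenomena.PercolationContinuityZ3.Theorems.SahiThreeCopy

open Finset Function Literature.Combinatorics.Sahi2008
open scoped BigOperators

/-! ### Decoding table entries (k = 5) -/

section Decode5

/-- An entry of the `k = 5` certificate table: `(fmask, profile bit code, S, counts, tab packed, nu packed, lam packed, faces)`,
faces = list of `(i, v, j, v', B packed)`, halves = list of `(side, j, v, B packed)`; the profile is `π_i = 1 + bit_i` (interior profiles `{1,2}^5` only). [this work] -/
abbrev Entry5 := ℕ × ℕ × ℕ × ℕ × ℕ × ℕ × ℕ × List (ℕ × ℕ × ℕ × ℕ × ℕ) × List (ℕ × ℕ × ℕ × ℕ)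

/-- Field accessors. [this work] -/
def Entry5.fm (e : Entry5) : ℕ := e.1
/-- … [this work] -/
def Entry5.pb (e : Entry5) : ℕ := e.2.1
/-- … [this work] -/
def Entry5.S (e : Entry5) : ℕ := e.2.2.1
/-- … [this work] -/
def Entry5.cnt (e : Entry5) : ℕ := e.2.2.2.1
/-- … [this work] -/
def Entry5.tabP (e : Entry5) : ℕ := e.2.2.2.2.1
/-- … [this work] -/
def Entry5.nuP (e : Entry5) : ℕ := e.2.2.2.2.2.1
/-- … [this work] -/
def Entry5.lamP (e : Entry5) : ℕ := e.2.2.2.2.2.2.1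
/-- … [this work] -/
def Entry5.faces (e : Entry5) : List (ℕ × ℕ × ℕ × ℕ × ℕ) := e.2.2.2.2.2.2.2.1
/-- … [this work] -/
def Entry5.halves (e : Entry5) : List (ℕ × ℕ × ℕ × ℕ) := e.2.2.2.2.2.2.2.2

/-- The integer weight table `S·θ` (32 digits base `2^cb`). [this work] -/
def tabOf5 (cb tabP : ℕ) : Array ℤ := ((digitsLE (2 ^ cb) 32 tabP).map fun d => (d : ℤ)).toArray

/-- The `(N1)` flow terms (`n` digits base `2^(cb+10)`, each `c·2^10 + lo·2^5 + hi`). [this work] -/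
def nuOf5 (cb n nuP : ℕ) : List (ℕ × ℕ × ℕ) :=
  (digitsLE (2 ^ (cb + 10)) n nuP).map fun d => (d / 2 ^ 10, d / 2 ^ 5 % 32, d % 32)

/-- The `(N2)` flow terms (`n` digits base `2^(cb+20)`, each `c·2^20 + lo₁·2^15 + hi₁·2^10 + lo₂·2^5 + hi₂`). [this work] -/
def lamOf5 (cb n lamP : ℕ) : List (ℕ × ℕ × ℕ × ℕ × ℕ) :=
  (digitsLE (2 ^ (cb + 20)) n lamP).map fun d => (d / 2 ^ 20, d / 2 ^ 15 % 32, d / 2 ^ 10 % 32, d / 2 ^ 5 % 32, d % 32)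

/-- A face matrix (`256` digits base `2^32`, entry `u·16+w`, offset `2^31`). [this work] -/
def faceMat5 (bp : ℕ) : Vector (Vector ℤ (2 ^ 4)) (2 ^ 4) :=
  let ds := digitsLE (2 ^ 32) 256 bp
  Vector.ofFn fun u : Fin (2 ^ 4) => Vector.ofFn fun w : Fin (2 ^ 4) => ((ds.getD ((u : ℕ) * 16 + (w : ℕ)) 0 : ℕ) : ℤ) - 2 ^ 31

/-- A decoded (cross-)face form `(i, v, j, v', B)`. [this work] -/
abbrev FaceForm5 := ℕ × ℕ × ℕ × ℕ × Vector (Vector ℤ (2 ^ 4)) (2 ^ 4)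

/-- Decoding the face list of an entry once. [this work] -/
def decodeFaces5 (fs : List (ℕ × ℕ × ℕ × ℕ × ℕ)) : List FaceForm5 :=
  fs.map fun f => (f.1, f.2.1, f.2.2.1, f.2.2.2.1, faceMat5 f.2.2.2.2)

/-- The global kernel of a decoded face form. [this work] -/
def FaceForm5.ker (f : FaceForm5) (x y : Fin (2 ^ 5)) : ℤ := faceKer f.1 f.2.1 f.2.2.1 f.2.2.2.1 f.2.2.2.2 x y

/-- The extra kernel table of an entry: the sum of its (decoded) face forms. [this work] -/
def faceTable5 (fds : List FaceForm5) : Vector (Vector ℤ (2 ^ 5)) (2 ^ 5) :=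
  Vector.ofFn fun x => Vector.ofFn fun y => (fds.map fun f => f.ker x y).sum

/-- All (decoded) faces of an entry are in range and valid (w.r.t. the local family list `U4`). [this work] -/
def facesOK5 (U4 : Finset (Finset (Fin (2 ^ 4)))) (fds : List FaceForm5) : Bool :=
  fds.all fun f => decide (f.1 < 5) && decide (f.2.1 < 2) && decide (f.2.2.1 < 5) && decide (f.2.2.2.1 < 2) && faceOK U4 f.2.2.2.2

/-- ★ The face table of a valid face list is nonnegative on all pairs of up-closed families. [this work] -/
theorem faceTable5_sum_nonneg {fds : List FaceForm5} (h : facesOK5 (upSetsC 4) fds = true) :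
    ∀ V ∈ upSetsC 5, ∀ W ∈ upSetsC 5, 0 ≤ ∑ x ∈ V, ∑ y ∈ W, ((faceTable5 fds)[x])[y] := by
  intro V hV W hW
  simp only [faceTable5, Fin.getElem_fin, Vector.getElem_ofFn, Fin.eta]
  have hx : ∀ x ∈ V, ∑ y ∈ W, (fds.map fun f => f.ker x y).sum = (fds.map fun f => ∑ y ∈ W, f.ker x y).sum :=
    fun x _ => sum_list_map_comm W fds (fun f y => f.ker x y)
  rw [Finset.sum_congr rfl hx, sum_list_map_comm]
  refine List.sum_nonneg ?_
  intro t ht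
  rw [List.mem_map] at ht
  obtain ⟨f, hf, rfl⟩ := ht
  unfold facesOK5 at h
  rw [List.all_eq_true] at h
  have hf' := h f hf
  simp only [Bool.and_eq_true, decide_eq_true_eq] at hf'
  obtain ⟨⟨⟨⟨hi, hv⟩, hj⟩, hv'⟩, hB⟩ := hf'
  exact faceKer_sum_nonneg (i := ⟨f.1, hi⟩) (v := ⟨f.2.1, hv⟩) (j := ⟨f.2.2.1, hj⟩) (v' := ⟨f.2.2.2.1, hv'⟩) hB hV hW

/-- A half-form matrix with rows = all codes (`512` digits base `2^32`, entry `16x + w`, offset `2^31`). [this work] -/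
def halfMat0 (bp : ℕ) : Vector (Vector ℤ (2 ^ 4)) (2 ^ 5) :=
  let ds := digitsLE (2 ^ 32) 512 bp
  Vector.ofFn fun x : Fin (2 ^ 5) => Vector.ofFn fun w : Fin (2 ^ 4) => ((ds.getD ((x : ℕ) * 16 + (w : ℕ)) 0 : ℕ) : ℤ) - 2 ^ 31

/-- A transposed half-form matrix with rows = local codes (`512` digits base `2^32`, entry `32u + y`, offset `2^31`). [this work] -/
def halfMat1 (bp : ℕ) : Vector (Vector ℤ (2 ^ 5)) (2 ^ 4) :=
  let ds := digitsLE (2 ^ 32) 512 bp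
  Vector.ofFn fun u : Fin (2 ^ 4) => Vector.ofFn fun y : Fin (2 ^ 5) => ((ds.getD ((u : ℕ) * 32 + (y : ℕ)) 0 : ℕ) : ℤ) - 2 ^ 31

/-- A decoded half form `(side, j, v, B₀, B₁)` (both decodings carried; `side` selects). [this work] -/
abbrev HalfForm5 := ℕ × ℕ × ℕ × Vector (Vector ℤ (2 ^ 4)) (2 ^ 5) × Vector (Vector ℤ (2 ^ 5)) (2 ^ 4)

/-- Decoding the half-form list of an entry once. [this work] -/
def decodeHalves5 (hs : List (ℕ × ℕ × ℕ × ℕ)) : List HalfForm5 :=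
  hs.map fun h => (h.1, h.2.1, h.2.2.1, halfMat0 h.2.2.2, halfMat1 h.2.2.2)

/-- The global kernel of a decoded half form. [this work] -/
def HalfForm5.ker (h : HalfForm5) (x y : Fin (2 ^ 5)) : ℤ :=
  if h.1 = 0 then halfKer h.2.1 h.2.2.1 h.2.2.2.1 x y else halfKerT h.2.1 h.2.2.1 h.2.2.2.2 x y

/-- The extra kernel table of the half forms of an entry. [this work] -/
def halfTable5 (hds : List HalfForm5) : Vector (Vector ℤ (2 ^ 5)) (2 ^ 5) :=
  Vector.ofFn fun x => Vector.ofFn fun y => (hds.map fun h => h.ker x y).sum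

/-- All half forms of an entry are in range and valid. [this work] -/
def halvesOK5 (U5 : Finset (Finset (Fin (2 ^ 5)))) (U4 : Finset (Finset (Fin (2 ^ 4)))) (hds : List HalfForm5) : Bool :=
  hds.all fun h => decide (h.2.1 < 5) && decide (h.2.2.1 < 2) &&
    (if h.1 = 0 then halfOK U5 U4 h.2.2.2.1 else halfOKT U5 U4 h.2.2.2.2)

/-- ★ The half-form table of a valid list is nonnegative on all pairs of up-closed families. [this work] -/
theorem halfTable5_sum_nonneg {hds : List HalfForm5} (h : halvesOK5 upList5 (upSetsC 4) hds = true) :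
    ∀ V ∈ upSetsC 5, ∀ W ∈ upSetsC 5, 0 ≤ ∑ x ∈ V, ∑ y ∈ W, ((halfTable5 hds)[x])[y] := by
  intro V hV W hW
  simp only [halfTable5, Fin.getElem_fin, Vector.getElem_ofFn, Fin.eta]
  have hx : ∀ x ∈ V, ∑ y ∈ W, (hds.map fun f => f.ker x y).sum = (hds.map fun f => ∑ y ∈ W, f.ker x y).sum :=
    fun x _ => sum_list_map_comm W hds (fun f y => f.ker x y)
  rw [Finset.sum_congr rfl hx, sum_list_map_comm]
  refine List.sum_nonneg ?_
  intro t ht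
  rw [List.mem_map] at ht
  obtain ⟨f, hf, rfl⟩ := ht
  unfold halvesOK5 at h
  rw [List.all_eq_true] at h
  have hf' := h f hf
  simp only [Bool.and_eq_true, decide_eq_true_eq] at hf'
  obtain ⟨⟨hj, hv⟩, hB⟩ := hf'
  unfold HalfForm5.ker
  by_cases h0 : f.1 = 0
  · simp only [h0, if_true] at hB ⊢
    exact halfKer_sum_nonneg (j := ⟨f.2.1, hj⟩) (v := ⟨f.2.2.1, hv⟩) hB hV hW
  · simp only [h0, if_false] at hB ⊢
    exact halfKerT_sum_nonneg (j := ⟨f.2.1, hj⟩) (v := ⟨f.2.2.1, hv⟩) hB hV hW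

/-- Entrywise sum of two kernel tables. [this work] -/
def addTable5 (X Y : Vector (Vector ℤ (2 ^ 5)) (2 ^ 5)) : Vector (Vector ℤ (2 ^ 5)) (2 ^ 5) :=
  Vector.ofFn fun x => Vector.ofFn fun y => (X[x])[y] + (Y[x])[y]

/-- Sums of tables nonnegative on pairs are nonnegative on pairs. [this work] -/
theorem addTable5_sum_nonneg {X Y : Vector (Vector ℤ (2 ^ 5)) (2 ^ 5)}
    (hX : ∀ V ∈ upSetsC 5, ∀ W ∈ upSetsC 5, 0 ≤ ∑ x ∈ V, ∑ y ∈ W, (X[x])[y])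
    (hY : ∀ V ∈ upSetsC 5, ∀ W ∈ upSetsC 5, 0 ≤ ∑ x ∈ V, ∑ y ∈ W, (Y[x])[y]) :
    ∀ V ∈ upSetsC 5, ∀ W ∈ upSetsC 5, 0 ≤ ∑ x ∈ V, ∑ y ∈ W, ((addTable5 X Y)[x])[y] := by
  intro V hV W hW
  simp only [addTable5, Fin.getElem_fin, Vector.getElem_ofFn, Finset.sum_add_distrib]
  exact add_nonneg (hX V hV W hW) (hY V hV W hW)

/-- The INTERIOR profile with bit code `pb < 32`: `π_i = 1 + bit_i(pb) ∈ {1,2}`. [this work] -/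
def profOfBits5 (pb : ℕ) : Fin 5 → ℕ := fun i => pb / 2 ^ (i : ℕ) % 2 + 1

/-- Base-4 code of a profile on 5 coordinates. [this work] -/
def profCode5 (π : Fin 5 → ℕ) : ℕ := ∑ i : Fin 5, π i * 4 ^ (i : ℕ)

/-- The family of codes with bitmask `fm`. [this work] -/
def setOfMask5 (fm : ℕ) : Finset (Fin (2 ^ 5)) := univ.filter fun y => fm.testBit y

/-- The check of ONE entry against the arrangement set `AT[pb]` and the local family list `U4`: faces + flow form. [this work] -/
def checkEntry5 (U5 : Finset (Finset (Fin (2 ^ 5)))) (U4 : Finset (Finset (Fin (2 ^ 4))))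
    (AT : Array (Finset (Fin (2 ^ 5) × Fin (2 ^ 5) × Fin (2 ^ 5)))) (e : Entry5) : Bool :=
  if e.cnt / 2 ^ 32 % 2 = 1 then
    -- BRUTE-FORCE entry: the sandwich facts are checked on all pairs from `U5` (the tree's `certOKfastZ`)
    decide (e.pb < 32) && decide (0 < e.S) &&
      certOKfastZ e.S (AT.getD e.pb ∅) U5 (U5.image maskOf) (setOfMask5 e.fm) (tabOf5 (e.cnt / 2 ^ 24 % 2 ^ 8) e.tabP)
  else
    let fds := decodeFaces5 e.faces
    let hds := decodeHalves5 e.halves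
    decide (e.pb < 32) && decide (0 < e.S) && facesOK5 U4 fds && halvesOK5 U5 U4 hds &&
      certOKflowXF e.S (AT.getD e.pb ∅) (setOfMask5 e.fm) (tabOf5 (e.cnt / 2 ^ 24 % 2 ^ 8) e.tabP)
        (nuOf5 (e.cnt / 2 ^ 24 % 2 ^ 8) (e.cnt % 2 ^ 12) e.nuP) (lamOf5 (e.cnt / 2 ^ 24 % 2 ^ 8) (e.cnt / 2 ^ 12 % 2 ^ 12) e.lamP)
        (addTable5 (faceTable5 fds) (halfTable5 hds))

/-- The arrangement sets of all `1024` profile codes. [this work] -/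
def arrTab5 : Array (Finset (Fin (2 ^ 5) × Fin (2 ^ 5) × Fin (2 ^ 5))) := Array.ofFn fun c : Fin 32 => arrSetC (profOfBits5 c)

/-- Reading `arrTab5`. [this work] -/
theorem arrTab5_getD {c : ℕ} (hc : c < 32) : arrTab5.getD c ∅ = arrSetC (profOfBits5 c) := by
  unfold arrTab5
  rw [Array.getD_eq_getD_getElem?, Array.getElem?_eq_getElem (by rw [Array.size_ofFn]; exact hc), Option.getD_some,
    Array.getElem_ofFn]

/-- ★ A passing entry yields the rational facts for `(profOfBits5 pb, setOfMask5 fm)`. [this work] -/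
theorem facts_of_checkEntry5 {e : Entry5} (h : checkEntry5 upList5 (upSetsC 4) arrTab5 e = true) :
    (∀ x : Fin (2 ^ 5), 0 ≤ thetaC (tabQof e.S 5 (tabOf5 (e.cnt / 2 ^ 24 % 2 ^ 8) e.tabP)) x) ∧
      (∀ V ∈ upSetsC 5, ∀ W ∈ upSetsC 5,
        0 ≤ N1C (arrSetC (profOfBits5 e.pb)) (setOfMask5 e.fm) (tabQof e.S 5 (tabOf5 (e.cnt / 2 ^ 24 % 2 ^ 8) e.tabP)) V W ∧
        0 ≤ N2C (arrSetC (profOfBits5 e.pb)) (setOfMask5 e.fm) (tabQof e.S 5 (tabOf5 (e.cnt / 2 ^ 24 % 2 ^ 8) e.tabP)) V W) := by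
  unfold checkEntry5 at h
  by_cases hb : e.cnt / 2 ^ 32 % 2 = 1
  · -- brute-force branch
    simp only [hb, if_true, Bool.and_eq_true, decide_eq_true_eq] at h
    obtain ⟨⟨hpb, hS⟩, hc⟩ := h
    rw [arrTab5_getD hpb] at hc
    obtain ⟨h0, h12⟩ := facts_of_certOKfastZ hS hc
    exact ⟨h0, fun V hV W hW => h12 V (mem_upList5 (upClosedC_of_mem hV)) W (mem_upList5 (upClosedC_of_mem hW))⟩
  · simp only [hb, if_false, Bool.and_eq_true, decide_eq_true_eq] at h
    obtain ⟨⟨⟨⟨hpb, hS⟩, hf⟩, hh⟩, hc⟩ := h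
    rw [arrTab5_getD hpb, certOKflowXF_eq] at hc
    exact facts_of_certOKflowX hS (addTable5_sum_nonneg (faceTable5_sum_nonneg hf) (halfTable5_sum_nonneg hh)) hc


/-- The SANDWICH FACTS of an entry: `θ ≥ 0` and `(N1), (N2) ≥ 0` on all pairs of up-closed code families. [this work] -/
def EntryFacts5 (e : Entry5) : Prop :=
  (∀ x : Fin (2 ^ 5), 0 ≤ thetaC (tabQof e.S 5 (tabOf5 (e.cnt / 2 ^ 24 % 2 ^ 8) e.tabP)) x) ∧
    (∀ V ∈ upSetsC 5, ∀ W ∈ upSetsC 5,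
      0 ≤ N1C (arrSetC (profOfBits5 e.pb)) (setOfMask5 e.fm) (tabQof e.S 5 (tabOf5 (e.cnt / 2 ^ 24 % 2 ^ 8) e.tabP)) V W ∧
      0 ≤ N2C (arrSetC (profOfBits5 e.pb)) (setOfMask5 e.fm) (tabQof e.S 5 (tabOf5 (e.cnt / 2 ^ 24 % 2 ^ 8) e.tabP)) V W)

/-- A passing entry check gives the facts. [this work] -/
theorem entryFacts5_of_check {e : Entry5} (h : checkEntry5 upList5 (upSetsC 4) arrTab5 e = true) : EntryFacts5 e :=
  facts_of_checkEntry5 h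

/-! #### Brute-force entries in PIECES (the pair enumeration split by residue classes of the row family's mask) -/

/-- One piece of the brute-force check of an entry: `S·θ ≥ 0`, the `(N1)` diagonal against ALL masks of `U5`, and the `(N2)` row
checks (the tree's `rowOK2`: row sums against all masks of `U5`, early exit on nonnegative rows) for the rows `V ∈ U5` with
`maskOf V % m = r`. [this work] -/
def brutePiece5 (U5 : Finset (Finset (Fin (2 ^ 5)))) (AT : Array (Finset (Fin (2 ^ 5) × Fin (2 ^ 5) × Fin (2 ^ 5)))) (e : Entry5)
    (m r : ℕ) : Bool :=
  let A := AT.getD e.pb ∅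
  let F := setOfMask5 e.fm
  let tab := tabOf5 (e.cnt / 2 ^ 24 % 2 ^ 8) e.tabP
  let d1 := diag1 e.S A F tab
  let K2 := kmat2F e.S A F tab
  let UM := U5.image maskOf
  decide (e.pb < 32) && decide (0 < e.S) && decide (∀ x : Fin (2 ^ 5), 0 ≤ thetaZ tab x) &&
    (allMem UM fun mk => decide (0 ≤ sumBits d1 mk (2 ^ 5))) &&
    allMem (U5.filter fun V => maskOf V % m = r) fun V => rowOK2 K2 UM V

/-- ★ All `m` pieces of the brute-force check give the facts of the entry. [this work] -/
theorem entryFacts5_of_brutePieces {e : Entry5} {m : ℕ} (hm : 0 < m)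
    (h : ∀ r < m, brutePiece5 upList5 arrTab5 e m r = true) : EntryFacts5 e := by
  have h0 := h 0 hm
  unfold brutePiece5 at h0
  simp only [Bool.and_eq_true, decide_eq_true_eq, allMem_eq_true, kmat2F_eq] at h0
  obtain ⟨⟨⟨⟨hpb, hS⟩, hθ⟩, hd⟩, _⟩ := h0
  have hSq : (0 : ℚ) < e.S := by exact_mod_cast hS
  refine ⟨fun x => ?_, fun V hV W hW => ⟨?_, ?_⟩⟩
  · rw [thetaC_tabQof]; exact div_nonneg (by exact_mod_cast hθ x) hSq.le
  · -- (N1): diagonal sum over `V ∩ W`, an up-closed family, hence in `upList5`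
    have hVW5 : V ∩ W ∈ upList5 := mem_upList5 (upClosedC_of_mem (inter_mem_upSetsC hV hW))
    have h1 := hd (maskOf (V ∩ W)) (Finset.mem_image_of_mem _ hVW5)
    rw [sumBits_maskOf] at h1
    rw [arrTab5_getD hpb] at h1
    simp only [diag1_getD] at h1
    have h1c : (0 : ℚ) ≤ ((∑ x ∈ V ∩ W, N1Z e.S (arrSetC (profOfBits5 e.pb)) (setOfMask5 e.fm)
        (tabOf5 (e.cnt / 2 ^ 24 % 2 ^ 8) e.tabP) {x} {x} : ℤ) : ℚ) := by exact_mod_cast h1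
    rw [Int.cast_sum] at h1c
    have h1' : (0 : ℚ) ≤ e.S * N1C (arrSetC (profOfBits5 e.pb)) (setOfMask5 e.fm)
        (tabQof e.S 5 (tabOf5 (e.cnt / 2 ^ 24 % 2 ^ 8) e.tabP)) V W := by
      rw [N1C_eq_sum_inter, Finset.mul_sum]
      exact h1c.trans_eq (Finset.sum_congr rfl fun x _ => cast_N1Z hS _ _ _ {x} {x})
    exact (mul_nonneg_iff_of_pos_left hSq).1 h1'
  · -- (N2): the row of `V` (in the piece of its residue) against the mask of `W`
    have hV5 : V ∈ upList5 := mem_upList5 (upClosedC_of_mem hV)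
    have hW5 : W ∈ upList5 := mem_upList5 (upClosedC_of_mem hW)
    have hr' := h (maskOf V % m) (Nat.mod_lt _ hm)
    unfold brutePiece5 at hr'
    simp only [Bool.and_eq_true, decide_eq_true_eq, allMem_eq_true, kmat2F_eq] at hr'
    have hr := hr'.2 V (Finset.mem_filter.2 ⟨hV5, rfl⟩)
    rw [arrTab5_getD hpb] at hr
    unfold rowOK2 at hr
    rw [Bool.or_eq_true, allMem_eq_true] at hr
    set A := arrSetC (profOfBits5 e.pb)
    set F := setOfMask5 e.fm
    set tab := tabOf5 (e.cnt / 2 ^ 24 % 2 ^ 8) e.tabP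
    have h2 : 0 ≤ ∑ y ∈ W, (rowSum (kmat2 e.S A F tab) V).getD (y : ℕ) 0 := by
      rcases hr with hnn | hall
      · exact Finset.sum_nonneg fun y _ => allNonneg_getD hnn y y.isLt
      · have := hall (maskOf W) (Finset.mem_image_of_mem _ hW5)
        rwa [decide_eq_true_eq, sumBits_maskOf] at this
    simp only [rowSum_getD, kmat2, Fin.getElem_fin, Vector.getElem_ofFn, Fin.eta] at h2
    have h2c : (0 : ℚ) ≤ ((∑ y ∈ W, ∑ x ∈ V, N2Z e.S A F tab {x} {y} : ℤ) : ℚ) := by exact_mod_cast h2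
    rw [Int.cast_sum] at h2c
    have h2' : (0 : ℚ) ≤ e.S * N2C A F (tabQof e.S 5 tab) V W := by
      rw [N2C_eq_sum_singleton, Finset.sum_comm, Finset.mul_sum]
      refine h2c.trans_eq (Finset.sum_congr rfl fun y _ => ?_)
      rw [Int.cast_sum, Finset.mul_sum]
      exact Finset.sum_congr rfl fun x _ => cast_N2Z hS A F tab {x} {y}
    exact (mul_nonneg_iff_of_pos_left hSq).1 h2'

end Decode5

end Summit.CriticalPhenomena.PercolationContinuityZ3.Theorems.SahiThreeCopy
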